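import Summits.FinalStateConjecture.FinalStateConjecture.Theses.SwallowTheDatum
import Summits.FinalStateConjecture.FinalStateConjecture.Theorems.SwallowTheDatumUniversalWitnessFamily
import Literature.Geometry.Lorentzian.KerrDataProofs
import Literature.Geometry.Lorentzian.KerrSchildCoord

/-!
# Crux UniversalWitnessFamily (stmt-FinalStateConjecture-10051) — ideator 1, round 1: first lemmas

Two target-level re-cuts of the route's glue `ParametricKerrBurial → KerrShieldedSettles →
MGHDExists → UniversalWitnessFamily`, each with its new interface predicate, the new glue PROVED
(pure logic), and the comparison with the route's own decls PROVED:

* Card `spin-is-dead-weight`: `ParametricSchwarzschildBurial → SchwarzschildShieldedSettles →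
  MGHDExists → UniversalWitnessFamily`, with `KerrShieldedSettles → SchwarzschildShieldedSettles`
  and `ParametricSchwarzschildBurial → ParametricKerrBurial`.
* Card `hand-over-a-development`: `ParametricKerrBurial → KerrHandover → HandoverSettles →
  MGHDExists → UniversalWitnessFamily`, through `KerrHandover → HandoverSettles →
  KerrShieldedSettles`; the lever `handover_embeds` is the typed `IsMaximal` itself.
-/

noncomputable section

namespace Summit.FinalStateConjecture.FinalStateConjecture.Cruxes.UniversalWitnessFamily.Sketch1

open Literature.Geometry.Lorentzian
open scoped Manifold ContDiff Topology
open Set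

-- instance search through nested operator types `E4 →L E4 →L E4 →L ℝ` (as in the tree files)
set_option maxSynthPendingDepth 3
set_option linter.dupNamespace false

/-! ## §0 The route's shielding predicate, verbatim, with `(M, a, r₁)` exposed -/

/-- The hard-coded bent height `T_{M,a}` of the route (verbatim). For `a = 0` and `r ≥ 8M` it is
`2M log ((r − 2M)/2M)`, i.e. the slice `t* = T(r)` is the time-symmetric Schwarzschild slice
`t_Schw = 0` (Flamm paraboloid, `k ≡ 0`) beyond `8M`. -/
def bentHeight (M a : ℝ) : ℝ → ℝ := fun r : ℝ =>
  Real.smoothTransition (r / (4 * M) - 1) *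
    (((M) / Real.sqrt ((M) ^ 2 - (a) ^ 2)) *
        (Kerr.rPlus M a * Real.log (r - Kerr.rPlus M a) -
          Kerr.rMinus M a * Real.log (r - Kerr.rMinus M a)) -
      ((M) / Real.sqrt ((M) ^ 2 - (a) ^ 2)) *
        (Kerr.rPlus M a * Real.log ((4 * M) - Kerr.rPlus M a) -
          Kerr.rMinus M a * Real.log ((4 * M) - Kerr.rMinus M a)))

/-- `S_{M,a,r₁}(D)`: the route's shielding block (items 10052/10054/10055), verbatim, with the
parameters exposed. -/
def IsShieldedWith [Kerr.Facts] (M a r₁ : ℝ) (X : Type) [TopologicalSpace X]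
    [ChartedSpace E3 X] [IsManifold (𝓡 3) ∞ X] (D : InitialDataSet (𝓡 3) X) : Prop :=
  ∃ (hM : 0 ≤ M) (T : ℝ → ℝ) (φ : Kerr.slice a r₁ → X)
    (ψ : Kerr.slice a r₁ → Kerr.region a r₁) (ν : NormalField 𝓘(ℝ, E4) ψ),
    |a| < M ∧ Kerr.rMinus M a < r₁ ∧ r₁ < Kerr.rPlus M a ∧ T = bentHeight M a ∧
    IsCompact (Set.range φ)ᶜ ∧ Topology.IsOpenEmbedding φ ∧
    ContMDiff 𝓘(ℝ, E3) (𝓡 3) ∞ φ ∧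
    (∀ y : Kerr.slice a r₁, (ψ y : E4) =
      E4.ofTimeSpace (T (Kerr.radius a (E4.ofTimeSpace 0 (y : E3)))) (y : E3)) ∧
    (Kerr.smoothMetric M a r₁).IsSpacelikeImmersion 𝓘(ℝ, E3) ψ ∧
    (Kerr.smoothMetric M a r₁).IsFutureUnitNormal 𝓘(ℝ, E3)
      ((Kerr.timeOrientation M a r₁ hM).ofLE le_top) ψ ν ∧
    (∀ y : Kerr.slice a r₁,
      pullbackBilin (I := 𝓡 3) (I' := 𝓘(ℝ, E3)) φ D.h.inner y =
        pullbackBilin (I := 𝓘(ℝ, E4)) (I' := 𝓘(ℝ, E3)) ψ (Kerr.smoothMetric M a r₁).val y) ∧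
    (∀ [(Kerr.smoothMetric M a r₁).HasLeviCivita] (y : Kerr.slice a r₁),
      (pullbackBilin (I := 𝓡 3) (I' := 𝓘(ℝ, E3)) φ D.k y).toLinearMap₁₂ =
        (Kerr.smoothMetric M a r₁).secondFundamentalForm 𝓘(ℝ, E3) ψ ν y)

/-- The `∀`-MGHD conjunct of the summit's conclusion `P` at a datum `D` (verbatim the tail of
`UniversalWitnessFamily` / `KerrShieldedSettles`). -/
def SettlesInEveryMGHD (X : Type) [TopologicalSpace X] [ChartedSpace E3 X]
    [IsManifold (𝓡 3) ∞ X] [T2Space X] [SecondCountableTopology X] [ConnectedSpace X]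
    (D : InitialDataSet (𝓡 3) X) : Prop :=
  ∀ 𝒟 : VacuumCauchyDevelopment D, 𝒟.IsMaximal →
    Summit.FinalStateConjecture.HasCompleteNullInfinity 𝒟.toCauchyDevelopment ∧
      ∃ (O : Set 𝒟.carrier) (dec : FinalStateDecomposition 𝒟.toSpacetime O 2),
        (∀ i, Kerr.IsSubextremal (dec.mass i) (dec.spin i)) ∧
          O = Summit.FinalStateConjecture.exteriorOf 𝒟.toCauchyDevelopment dec.charted ∧
            Summit.FinalStateConjecture.HasExhaustiveCharts dec

/-! ## §1 Card `spin-is-dead-weight`: the target needs only Schwarzschild shields -/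

/-- Burial with SCHWARZSCHILD shields (`a = 0`; junction `0 < r₁ < 2M`; far slice = Flamm
paraboloid beyond `8M`). Stronger than `ParametricKerrBurial` (proved below), and delivered by
every engine in the burial pool that can fix the spin (Kehle–Unger Thm 1 targets; `V₄`-symmetric
Li–Mei seeds by equivariance; the universal collar at `a = 0`). -/
def ParametricSchwarzschildBurial : Prop :=
  ∀ [Kerr.Facts] (X : Type) [TopologicalSpace X] [ChartedSpace E3 X] [IsManifold (𝓡 3) ∞ X]
    [T2Space X] [SecondCountableTopology X] [ConnectedSpace X],
    ∀ d ∈ admissibleVacuumData X,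
      ∃ F : EuclideanSpace ℝ (Fin 1) → InitialDataSet (𝓡 3) X,
        InitialDataSet.IsSmoothDataFamily 1 F ∧ F 0 = d ∧ Function.Injective F ∧
          (∀ c, F c ∈ admissibleVacuumData X) ∧
            ∀ c ≠ 0, ∃ M r₁ : ℝ, IsShieldedWith M 0 r₁ X (F c)

/-- Settling for SCHWARZSCHILD-shielded data only: `KerrShieldedSettles` restricted to `a = 0`
(weaker than the route's item 10054, proved below). At `a = 0` the exact region is vacuum by the
PROVED `Kerr.isRicciFlat_zero_spin`, the far slice is exactly time-symmetric (DR rates trivial),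
null-ray sojourn bounds reduce to the radial effective potential, and the bent-slice
spacelikeness is a one-variable inequality. -/
def SchwarzschildShieldedSettles : Prop :=
  ∀ [Kerr.Facts] (X : Type) [TopologicalSpace X] [ChartedSpace E3 X] [IsManifold (𝓡 3) ∞ X]
    [T2Space X] [SecondCountableTopology X] [ConnectedSpace X],
    ∀ D ∈ admissibleVacuumData X, (∃ M r₁ : ℝ, IsShieldedWith M 0 r₁ X D) →
      SettlesInEveryMGHD X D

/-- `ParametricSchwarzschildBurial` is the `a = 0` instance of the route's burial crux, hence
implies it (take `a := 0`). -/
theorem parametricKerrBurial_of_schwarzschild (hB : ParametricSchwarzschildBurial) :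
    Theses.SwallowTheDatum.ParametricKerrBurial := by
  unfold ParametricSchwarzschildBurial at hB
  unfold Theses.SwallowTheDatum.ParametricKerrBurial
  intro inst X _ _ _ _ _ _ d hd
  obtain ⟨F, hF, h0, hinj, hadm, hsh⟩ := hB X d hd
  refine ⟨F, hF, h0, hinj, hadm, fun c hc ↦ ?_⟩
  obtain ⟨M, r₁, hM, T, φ, ψ, ν, hrest⟩ := hsh c hc
  exact ⟨M, 0, r₁, hM, T, φ, ψ, ν, hrest⟩

/-- The route's settling crux (all `|a| < M`) implies the Schwarzschild one (instantiate
`a := 0`): provers of item 10054 lose nothing, the target needs less. -/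
theorem schwarzschildShieldedSettles_of_kerr (hS : Theses.SwallowTheDatum.KerrShieldedSettles) :
    SchwarzschildShieldedSettles := by
  unfold Theses.SwallowTheDatum.KerrShieldedSettles at hS
  unfold SchwarzschildShieldedSettles SettlesInEveryMGHD
  intro inst X _ _ _ _ _ _ D hD hsh
  obtain ⟨M, r₁, hM, T, φ, ψ, ν, hrest⟩ := hsh
  exact hS X D hD ⟨M, 0, r₁, hM, T, φ, ψ, ν, hrest⟩

/-- **New glue (card `spin-is-dead-weight`).** Schwarzschild burial, Schwarzschild settling and
MGHD existence give the target. Pure logic (same proof as the landed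
`universalWitnessFamily_of_burial_of_settles_of_mghd`). -/
theorem universalWitnessFamily_of_schwarzschild (hB : ParametricSchwarzschildBurial)
    (hS : SchwarzschildShieldedSettles) (hM : Theses.SwallowTheDatum.MGHDExists) :
    Theses.SwallowTheDatum.UniversalWitnessFamily := by
  unfold ParametricSchwarzschildBurial at hB
  unfold SchwarzschildShieldedSettles SettlesInEveryMGHD at hS
  unfold Theses.SwallowTheDatum.MGHDExists at hM
  unfold Theses.SwallowTheDatum.UniversalWitnessFamily
  intro X _ _ _ _ _ _ d hd
  haveI : Kerr.Facts :=
    ⟨Kerr.isConnected_region_holds, Kerr.contMDiff_bilin_holds, Kerr.contMDiff_timeVector_holds⟩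
  obtain ⟨F, hF, h0, hinj, hadm, hsh⟩ := hB X d hd
  exact ⟨F, hF, h0, hinj, hadm, fun c hc ↦ ⟨hM X (F c) (hadm c), hS X (F c) (hadm c) (hsh c hc)⟩⟩

/-! ## §2 Card `hand-over-a-development`: maximality on the receiving side -/

/-- **The lever, verbatim the typed `IsMaximal`.** ANY vacuum Cauchy development of the SAME
datum embeds (smooth, isometric, time-orientation preserving, over `ι`) into every maximal one —
so whoever can exhibit ONE development of the buried member containing the exact Kerr–Schild
future of the shield has placed that exact region inside every MGHD, with no sub-data
maximality, no maximal common development and no boundary-point analysis. -/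
theorem handover_embeds {X : Type} [TopologicalSpace X] [ChartedSpace E3 X]
    [IsManifold (𝓡 3) ∞ X] [ConnectedSpace X] {D : InitialDataSet (𝓡 3) X}
    (𝒟₀ 𝒟 : VacuumCauchyDevelopment D) (h𝒟 : 𝒟.IsMaximal) :
    𝒟₀.toCauchyDevelopment.EmbedsInto 𝒟.toCauchyDevelopment :=
  h𝒟 𝒟₀

/-- `HandsOver X D 𝒟₀`: the datum `D` is Kerr-shielded (route block, verbatim) AND the vacuum
Cauchy development `𝒟₀` of the WHOLE datum carries a smooth, isometric, time-orientation
preserving open embedding `Φ` of the thick Kerr–Schild future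
`W = {r > r₃, t* > T(r) − δ}` (`r₁ ≤ r₃ < r₊`, `δ > 0`) of the bent slice, matching the data
embedding on the slice: `Φ (T(r(z)), z) = ι (φ z)`. The interface object of the re-cut: a PAIR
(datum, development ⊇ exact region), not a datum. -/
def HandsOver [Kerr.Facts] (X : Type) [TopologicalSpace X] [ChartedSpace E3 X]
    [IsManifold (𝓡 3) ∞ X] [ConnectedSpace X] (D : InitialDataSet (𝓡 3) X)
    (𝒟₀ : VacuumCauchyDevelopment D) : Prop :=
  ∃ (M a r₁ : ℝ) (hM : 0 ≤ M) (T : ℝ → ℝ) (φ : Kerr.slice a r₁ → X)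
    (ψ : Kerr.slice a r₁ → Kerr.region a r₁) (ν : NormalField 𝓘(ℝ, E4) ψ),
    (|a| < M ∧ Kerr.rMinus M a < r₁ ∧ r₁ < Kerr.rPlus M a ∧ T = bentHeight M a ∧
    IsCompact (Set.range φ)ᶜ ∧ Topology.IsOpenEmbedding φ ∧
    ContMDiff 𝓘(ℝ, E3) (𝓡 3) ∞ φ ∧
    (∀ y : Kerr.slice a r₁, (ψ y : E4) =
      E4.ofTimeSpace (T (Kerr.radius a (E4.ofTimeSpace 0 (y : E3)))) (y : E3)) ∧
    (Kerr.smoothMetric M a r₁).IsSpacelikeImmersion 𝓘(ℝ, E3) ψ ∧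
    (Kerr.smoothMetric M a r₁).IsFutureUnitNormal 𝓘(ℝ, E3)
      ((Kerr.timeOrientation M a r₁ hM).ofLE le_top) ψ ν ∧
    (∀ y : Kerr.slice a r₁,
      pullbackBilin (I := 𝓡 3) (I' := 𝓘(ℝ, E3)) φ D.h.inner y =
        pullbackBilin (I := 𝓘(ℝ, E4)) (I' := 𝓘(ℝ, E3)) ψ (Kerr.smoothMetric M a r₁).val y) ∧
    (∀ [(Kerr.smoothMetric M a r₁).HasLeviCivita] (y : Kerr.slice a r₁),
      (pullbackBilin (I := 𝓡 3) (I' := 𝓘(ℝ, E3)) φ D.k y).toLinearMap₁₂ =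
        (Kerr.smoothMetric M a r₁).secondFundamentalForm 𝓘(ℝ, E3) ψ ν y)) ∧
    ∃ (r₃ δ : ℝ) (W : TopologicalSpace.Opens E4) (Φ : W → 𝒟₀.carrier),
      r₁ ≤ r₃ ∧ r₃ < Kerr.rPlus M a ∧ 0 < δ ∧
      ((W : Set E4) = {x | r₃ < Kerr.radius a x ∧ T (Kerr.radius a x) - δ < x 0}) ∧
      ContMDiff 𝓘(ℝ, E4) (𝓡 4) ∞ Φ ∧ Topology.IsOpenEmbedding Φ ∧
      (∀ y : W, pullbackBilin (I := 𝓡 4) (I' := 𝓘(ℝ, E4)) Φ 𝒟₀.metric.val y =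
        Kerr.bilin M a (y : E4)) ∧
      (∀ y : W, 𝒟₀.timeOrientation.IsFutureDirected
        (mfderiv 𝓘(ℝ, E4) (𝓡 4) Φ y (Kerr.timeVector M a (y : E4)))) ∧
      (∀ (y : W) (z : Kerr.slice a r₁),
        (y : E4) = E4.ofTimeSpace (T (Kerr.radius a (E4.ofTimeSpace 0 (z : E3)))) (z : E3) →
          Φ y = 𝒟₀.embed (φ z))

/-- **Handover (the new item).** Every Kerr-shielded admissible datum has SOME vacuum Cauchy
development handing over the exact Kerr–Schild future of its shield. For hyperbolic burial
engines this is their native output; for elliptic engines it is: common-development existence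
(Choquet-Bruhat–Geroch 1969 Thm 2 / Sbierski 2016 Thm 2.4(ii), the named fact item 10053 also
needs) for the exterior sub-datum + an explicit thin/thick two-piece pushout with the Kerr–Schild
region (Hausdorff by shaping, because the pushout may be as THIN as we like near the seam —
maximality is spent on the receiving side) + `Kerr.isRicciFlat` (proved at `a = 0`). -/
def KerrHandover : Prop :=
  ∀ [Kerr.Facts] (X : Type) [TopologicalSpace X] [ChartedSpace E3 X] [IsManifold (𝓡 3) ∞ X]
    [T2Space X] [SecondCountableTopology X] [ConnectedSpace X],
    ∀ D ∈ admissibleVacuumData X, (∃ M a r₁ : ℝ, IsShieldedWith M a r₁ X D) →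
      ∃ 𝒟₀ : VacuumCauchyDevelopment D, HandsOver X D 𝒟₀

/-- **Settling from a handed-over development.** If `𝒟₀` hands over the exact future `W` of the
shield, then EVERY maximal `𝒟` satisfies the `∀`-MGHD clauses of `P`: `𝒟₀ ↪ 𝒟` by
`handover_embeds`; `O = J⁺(ι X) ∩ I⁻(charts) ⊆ (image of W ∩ {t* ≥ T})` because a past-directed
causal curve from the image can leave it only across the bent slice (achronality of the Cauchy
hypersurface `ι X`; `r` increases pastwards inside `r < r₊`; `t*` is a time function); then
exact-Kerr bookkeeping as in item 10054. Item 10053 (`SubdataDevelopmentsEmbed`) is not used. -/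
def HandoverSettles : Prop :=
  ∀ [Kerr.Facts] (X : Type) [TopologicalSpace X] [ChartedSpace E3 X] [IsManifold (𝓡 3) ∞ X]
    [T2Space X] [SecondCountableTopology X] [ConnectedSpace X],
    ∀ D ∈ admissibleVacuumData X, ∀ 𝒟₀ : VacuumCauchyDevelopment D, HandsOver X D 𝒟₀ →
      SettlesInEveryMGHD X D

/-- **Glued split of item 10054 by the handover**: `KerrHandover → HandoverSettles →
KerrShieldedSettles` (pure logic). -/
theorem kerrShieldedSettles_of_handover (hH : KerrHandover) (hHS : HandoverSettles) :
    Theses.SwallowTheDatum.KerrShieldedSettles := by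
  unfold KerrHandover at hH
  unfold HandoverSettles SettlesInEveryMGHD at hHS
  unfold Theses.SwallowTheDatum.KerrShieldedSettles
  intro inst X _ _ _ _ _ _ D hD hsh 𝒟 h𝒟
  obtain ⟨M, a, r₁, hM, T, φ, ψ, ν, hrest⟩ := hsh
  obtain ⟨𝒟₀, h𝒟₀⟩ := hH X D hD ⟨M, a, r₁, hM, T, φ, ψ, ν, hrest⟩
  exact hHS X D hD 𝒟₀ h𝒟₀ 𝒟 h𝒟

/-- **New glue (card `hand-over-a-development`)**: the target from burial, handover, handover
settling and MGHD existence — through the landed reduction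
`Theorems.SwallowTheDatum.universalWitnessFamily_of_burial_of_settles_of_mghd`. -/
theorem universalWitnessFamily_of_handover (hB : Theses.SwallowTheDatum.ParametricKerrBurial)
    (hH : KerrHandover) (hHS : HandoverSettles) (hM : Theses.SwallowTheDatum.MGHDExists) :
    Theses.SwallowTheDatum.UniversalWitnessFamily :=
  Theorems.SwallowTheDatum.universalWitnessFamily_of_burial_of_settles_of_mghd hB
    (kerrShieldedSettles_of_handover hH hHS) (by
      unfold Theses.SwallowTheDatum.MGHDExists at hM
      exact hM)

/-- Both cards at once: Schwarzschild burial + handover + handover settling + MGHD existence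
give the target (the handover items are then unconditional on `Kerr.isRicciFlat`, which is
proved at `a = 0`). -/
theorem universalWitnessFamily_of_schwarzschild_handover (hB : ParametricSchwarzschildBurial)
    (hH : KerrHandover) (hHS : HandoverSettles) (hM : Theses.SwallowTheDatum.MGHDExists) :
    Theses.SwallowTheDatum.UniversalWitnessFamily :=
  universalWitnessFamily_of_handover (parametricKerrBurial_of_schwarzschild hB) hH hHS hM

end Summit.FinalStateConjecture.FinalStateConjecture.Cruxes.UniversalWitnessFamily.Sketch1

end
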